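import Mathlib
import Summits.PneNP.PneNP.Theorems.CnfIdealGenLengthRankDefectRepresentationsHalvesBudget
import Summits.PneNP.PneNP.Theorems.CnfIdealGenLengthRankDefectRepresentationsDoubleMaxCutTwoClasses
import Summits.PneNP.PneNP.Theorems.CnfIdealGenLengthRankDefectRepresentationsDoubleMaxCutQuadratic

/-!
# Crux `RankDefectRepresentations` (stmt-PneNP-18923), line `rank-dehn-ladder`: the TWO-HALVES DISCOUNT (registered tool stub W6
# `stub_halvesDiscount`, lead g15 RESHAPE 10b; memo `Cruxes/RankDefectRepresentations/Lines/rank-dehn-ladder-g15.md` §7, briefs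
# `…-briefs-g15b.md` §W6)

MERGE setting: the second family has `n' + 1` coordinates and the data `D` has ZERO CROSS DATA at the last one; `H₀`, `H₁` are the two
halves (the cells whose row AND column last bits are `false`, resp. `true`), and every double cut of `D` is `≤ c`.  For ANY double cut
`Φ₀ = doubleCut B₀ B'₀ H₀` of half `0` and ANY double cut `Φ₁ = doubleCut B₁ B'₁ H₁` of half `1` we prove `65·(Φ₀ + Φ₁) ≤ 129·c`
(in fact the argument gives `33·(Φ₀ + Φ₁) ≤ 65·c`): the two halves cannot both carry (nearly) the full budget.

Proof (memo §7, steps (1)–(4)).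
(1) COMPLEMENTARITY (`halves_sum_le`, from `stub_halvesBudget`, p708144): for every first-family set `B` and all `B'₀, B'₁`,
`doubleCut B B'₀ H₀ + doubleCut B B'₁ H₁ ≤ c` (the half-`b` double cut only sees the colours of `B'_b` with last bit `b`, and at
`B' := B'₀.filter (last = false) ∪ B'₁.filter (last = true)` the double cut of `D` is the sum of the two).  Hence `Φ_b ≤ c` and the
other half has profile `≤ c − Φ_b` at `B_b`.
(2) SURGERY (`exists_noCross_of_cuts_le`): for a matrix `M` with `doubleCut B₀ B' M ≤ δ` for all `B'`, the `B₀`-separated part of `M`,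
coloured by the SECOND family, has all bipartition cuts `≤ δ` (`…QuadrantCapture.cutJ_maskI_eq_doubleCut`), so g7's max-cut decomposition
(`…DoubleMaxCutTwoClasses.exists_blockDiagonal_of_cuts_le`) moves `M` by rank `≤ 4δ` to a matrix `M'` with NO VISIBLE DATA ACROSS `B₀`
(`M' x y = 0` whenever the first-family colours of `x, y` lie on different sides of `B₀` and the second-family colours differ).
(3) SYMMETRY (`doubleCut_eq_of_noCross`): for such an `M'` every block of every double cut is block-diagonal with respect to `B₀`
(`doubleCut_split`, `…QuadrantCapture.rank_add_of_disjoint`), and complementing the first-family argument inside `B₀` (or inside `B₀ᶜ`)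
only permutes that side's two blocks; so `doubleCut B̃ B' M' = doubleCut B B' M'` whenever `B̃` and `B` agree or are complementary on
`B₀` and on `B₀ᶜ`.  With `B̃ := {p | p ∈ B₀ ↔ p ∈ B₁}`: `B̃` agrees with `B₁` on `B₀` and is complementary to it off `B₀`, and agrees with
`B₀` on `B₁` and is complementary to it off `B₁`.
(4) PERTURBATION (`doubleCut_le_add_rank_sub`, from `…DoubleMaxCutQuadratic.doubleCut_sub_le` / `doubleCut_le_four_mul_rank`):
`doubleCut X ≤ doubleCut Y + 4·rank (X − Y)`.  Assembling: `Φ₁ ≤ doubleCut B̃ B'₁ H₁ + 32(c − Φ₀)`, `Φ₀ ≤ doubleCut B̃ B'₀ H₀ + 32(c − Φ₁)`,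
and (1) at `B̃` gives `Φ₀ + Φ₁ ≤ c + 32(2c − Φ₀ − Φ₁)`, i.e. `33(Φ₀ + Φ₁) ≤ 65c ≤ (129/65)·65c… ≤`, whence `65(Φ₀ + Φ₁) ≤ 129c`.
HONEST FRAMING: elementary linear algebra; a tool for the MERGE step of the line (the halving recursion branches with factor `< 2`);
`stub_merge` and the crux stay open; P ≠ NP is not moved; F-N2 is a FRONTIER formal rung.
-/

set_option linter.dupNamespace false -- `Summit.PneNP.PneNP.…`: summit = sub-problem name (D-0017)

namespace Summit.PneNP.PneNP.Theorems.CnfIdealGenLengthRankDefectRepresentationsHalvesDiscount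

open Matrix Finset
open Summit.PneNP.PneNP.Theorems.CnfIdealGenLengthRankDefectRepresentationsTwoFamilyCutDomination (colourI colourJ maskJ doubleCut)
open Summit.PneNP.PneNP.Theorems.CnfIdealGenLengthRankDefectRepresentationsQuadrantCapture
  (rank_add_of_disjoint cutJ_maskI_eq_doubleCut)
open Summit.PneNP.PneNP.Theorems.CnfIdealGenLengthRankDefectRepresentationsDoubleMaxCutTwoClasses (exists_blockDiagonal_of_cuts_le)
open Summit.PneNP.PneNP.Theorems.CnfIdealGenLengthRankDefectRepresentationsDoubleMaxCutQuadratic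
  (doubleCut_sub_le doubleCut_le_four_mul_rank)
open Summit.PneNP.PneNP.Theorems.CnfIdealGenLengthRankDefectRepresentationsMergeLowerBound (rank_neg')
open Summit.PneNP.PneNP.Theorems.CnfIdealGenLengthRankDefectRepresentationsHalvesBudget (stub_halvesBudget)

variable {K : Type} [Field K]

/-! ## Tools for a general two-family colouring -/

section General

variable {n n' : ℕ} {ι ι' : Type} [Fintype ι] [Fintype ι'] [DecidableEq ι] [DecidableEq ι']
variable (row : ι → Fin n ⊕ Fin n' → Bool) (col : ι' → Fin n ⊕ Fin n' → Bool)

/-- **Perturbation.**  Double cuts move by at most `4·rank` of the difference: `doubleCut X ≤ doubleCut Y + 4·rank (X − Y)`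
(subadditivity `doubleCut_sub_le` and `doubleCut_le_four_mul_rank`). -/
theorem doubleCut_le_add_rank_sub (B : Finset (Fin n → Bool)) (B' : Finset (Fin n' → Bool)) (X Y : Matrix ι ι' K) :
    doubleCut row col B B' X ≤ doubleCut row col B B' Y + 4 * (X - Y).rank := by
  have h1 : doubleCut row col B B' (Y - (Y - X)) ≤ doubleCut row col B B' Y + doubleCut row col B B' (Y - X) :=
    doubleCut_sub_le row col B B' Y (Y - X)
  rw [sub_sub_cancel] at h1
  have h2 := doubleCut_le_four_mul_rank row col B B' (Y - X)
  have h3 : (Y - X).rank = (X - Y).rank := by rw [← neg_sub, rank_neg']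
  omega

/-- **Surgery across a first-family set.**  If all double cuts `doubleCut B₀ B' M` (`B'` arbitrary) are `≤ δ`, then `M` is within rank `4δ`
of a matrix with NO VISIBLE DATA ACROSS `B₀`: the `B₀`-separated part of `M`, coloured by the second family, has all bipartition cuts `≤ δ`
(`cutJ_maskI_eq_doubleCut`), so the max-cut decomposition `exists_blockDiagonal_of_cuts_le` applies to it. -/
theorem exists_noCross_of_cuts_le (M : Matrix ι ι' K) (B₀ : Finset (Fin n → Bool)) (δ : ℕ)
    (hδ : ∀ B' : Finset (Fin n' → Bool), doubleCut row col B₀ B' M ≤ δ) :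
    ∃ M' : Matrix ι ι' K, (M - M').rank ≤ 4 * δ ∧
      ∀ x y, (colourI (row x) ∈ B₀) ≠ (colourI (col y) ∈ B₀) → colourJ (row x) ≠ colourJ (col y) → M' x y = 0 := by
  classical
  have hcuts : ∀ B' : Finset (Fin n' → Bool),
      (Matrix.of fun x y => if colourJ (row x) ∈ B' ∧ colourJ (col y) ∉ B' then
          (Matrix.of fun x y => if (colourI (row x) ∈ B₀) ≠ (colourI (col y) ∈ B₀) then M x y else (0 : K)) x y else 0).rank +
      (Matrix.of fun x y => if colourJ (row x) ∉ B' ∧ colourJ (col y) ∈ B' then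
          (Matrix.of fun x y => if (colourI (row x) ∈ B₀) ≠ (colourI (col y) ∈ B₀) then M x y else (0 : K)) x y else 0).rank
        ≤ δ := by
    intro B'
    rw [cutJ_maskI_eq_doubleCut]
    exact hδ B'
  obtain ⟨R', hR', hL⟩ :=
    exists_blockDiagonal_of_cuts_le (fun x => colourJ (row x)) (fun y => colourJ (col y)) _ δ hcuts
  refine ⟨M - ((Matrix.of fun x y => if (colourI (row x) ∈ B₀) ≠ (colourI (col y) ∈ B₀) then M x y else (0 : K)) - R'),
    ?_, ?_⟩
  · rw [sub_sub_cancel]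
    exact hL
  · intro x y hI hJ
    have hRxy : R' x y = 0 := hR' x y hJ
    rw [Matrix.sub_apply, Matrix.sub_apply, Matrix.of_apply, if_pos hI, hRxy, sub_zero, sub_self]

/-- **Block-diagonal splitting of a double cut.**  If `M` has no visible data across `B₀`, then every `B'`-masked entry of `M` across
`B₀` vanishes, so each of the two blocks of `doubleCut B B' M` is the block-diagonal sum of its `B₀ × B₀` piece and its `B₀ᶜ × B₀ᶜ`
piece, and the ranks add (`rank_add_of_disjoint`). -/
theorem doubleCut_split (M : Matrix ι ι' K) (B₀ B : Finset (Fin n → Bool)) (B' : Finset (Fin n' → Bool))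
    (hM : ∀ x y, (colourI (row x) ∈ B₀) ≠ (colourI (col y) ∈ B₀) → colourJ (row x) ≠ colourJ (col y) → M x y = 0) :
    doubleCut row col B B' M =
      ((Matrix.of fun x y => if (colourI (row x) ∈ B₀ ∧ colourI (col y) ∈ B₀) ∧ (colourI (row x) ∈ B ∧ colourI (col y) ∉ B)
          then maskJ row col B' M x y else 0).rank +
        (Matrix.of fun x y => if (colourI (row x) ∈ B₀ ∧ colourI (col y) ∈ B₀) ∧ (colourI (row x) ∉ B ∧ colourI (col y) ∈ B)
          then maskJ row col B' M x y else 0).rank) +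
      ((Matrix.of fun x y => if (colourI (row x) ∉ B₀ ∧ colourI (col y) ∉ B₀) ∧ (colourI (row x) ∈ B ∧ colourI (col y) ∉ B)
          then maskJ row col B' M x y else 0).rank +
        (Matrix.of fun x y => if (colourI (row x) ∉ B₀ ∧ colourI (col y) ∉ B₀) ∧ (colourI (row x) ∉ B ∧ colourI (col y) ∈ B)
          then maskJ row col B' M x y else 0).rank) := by
  classical
  -- the `B'`-masked matrix has no data at all across `B₀`
  have hN : ∀ x y, (colourI (row x) ∈ B₀) ≠ (colourI (col y) ∈ B₀) → maskJ row col B' M x y = 0 := by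
    intro x y h
    simp only [maskJ, Matrix.of_apply]
    split_ifs with hJ
    · refine hM x y h ?_
      intro e
      apply hJ
      rw [e]
    · rfl
  -- generic block splitting along `B₀`
  have blk : ∀ (A : ι → ι' → Prop) [∀ x y, Decidable (A x y)],
      (Matrix.of fun x y => if A x y then maskJ row col B' M x y else 0).rank =
        (Matrix.of fun x y => if (colourI (row x) ∈ B₀ ∧ colourI (col y) ∈ B₀) ∧ A x y then maskJ row col B' M x y else 0).rank +
        (Matrix.of fun x y => if (colourI (row x) ∉ B₀ ∧ colourI (col y) ∉ B₀) ∧ A x y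
          then maskJ row col B' M x y else 0).rank := by
    intro A _
    have e : (Matrix.of fun x y => if A x y then maskJ row col B' M x y else 0) =
        (Matrix.of fun x y => if (colourI (row x) ∈ B₀ ∧ colourI (col y) ∈ B₀) ∧ A x y then maskJ row col B' M x y else 0) +
        (Matrix.of fun x y => if (colourI (row x) ∉ B₀ ∧ colourI (col y) ∉ B₀) ∧ A x y
          then maskJ row col B' M x y else 0) := by
      ext x y
      simp only [Matrix.of_apply, Matrix.add_apply]
      by_cases h1 : colourI (row x) ∈ B₀ <;> by_cases h2 : colourI (col y) ∈ B₀
      · simp [h1, h2]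
      · have h0 := hN x y (by simp [h1, h2])
        simp [h1, h2, h0]
      · have h0 := hN x y (by simp [h1, h2])
        simp [h1, h2, h0]
      · simp [h1, h2]
    rw [e]
    refine rank_add_of_disjoint (fun x => colourI (row x) ∈ B₀) (fun y => colourI (col y) ∈ B₀) _ _ ?_ ?_
    · intro x y h
      simp only [Matrix.of_apply]
      rw [if_neg]
      exact fun h' => h h'.1
    · intro x y h
      simp only [Matrix.of_apply]
      rw [if_neg]
      exact fun h' => h h'.1
  unfold doubleCut
  rw [blk (fun x y => colourI (row x) ∈ B ∧ colourI (col y) ∉ B),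
    blk (fun x y => colourI (row x) ∉ B ∧ colourI (col y) ∈ B)]
  exact Nat.add_add_add_comm _ _ _ _

omit [Fintype ι] [Fintype ι'] [DecidableEq ι] [DecidableEq ι'] in
/-- On a side `P` where `B̃` and `B` AGREE, the `P × P` pieces of the two blocks are literally the same matrices. -/
theorem pieces_eq_of_agree (P : (Fin n → Bool) → Prop) [DecidablePred P] (N : Matrix ι ι' K) (B B₁ : Finset (Fin n → Bool))
    (h : ∀ p, P p → (p ∈ B₁ ↔ p ∈ B)) :
    (Matrix.of fun x y => if (P (colourI (row x)) ∧ P (colourI (col y))) ∧ (colourI (row x) ∈ B₁ ∧ colourI (col y) ∉ B₁)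
        then N x y else 0) =
      (Matrix.of fun x y => if (P (colourI (row x)) ∧ P (colourI (col y))) ∧ (colourI (row x) ∈ B ∧ colourI (col y) ∉ B)
        then N x y else 0) ∧
    (Matrix.of fun x y => if (P (colourI (row x)) ∧ P (colourI (col y))) ∧ (colourI (row x) ∉ B₁ ∧ colourI (col y) ∈ B₁)
        then N x y else 0) =
      (Matrix.of fun x y => if (P (colourI (row x)) ∧ P (colourI (col y))) ∧ (colourI (row x) ∉ B ∧ colourI (col y) ∈ B)
        then N x y else 0) := by
  constructor
  · ext x y
    simp only [Matrix.of_apply]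
    by_cases h1 : P (colourI (row x))
    · by_cases h2 : P (colourI (col y))
      · simp only [h _ h1, h _ h2]
      · simp [h2]
    · simp [h1]
  · ext x y
    simp only [Matrix.of_apply]
    by_cases h1 : P (colourI (row x))
    · by_cases h2 : P (colourI (col y))
      · simp only [h _ h1, h _ h2]
      · simp [h2]
    · simp [h1]

omit [Fintype ι] [Fintype ι'] [DecidableEq ι] [DecidableEq ι'] in
/-- On a side `P` where `B̃` and `B` are COMPLEMENTARY, the `P × P` pieces of the two blocks are swapped. -/
theorem pieces_eq_of_compl (P : (Fin n → Bool) → Prop) [DecidablePred P] (N : Matrix ι ι' K) (B B₁ : Finset (Fin n → Bool))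
    (h : ∀ p, P p → (p ∈ B₁ ↔ p ∉ B)) :
    (Matrix.of fun x y => if (P (colourI (row x)) ∧ P (colourI (col y))) ∧ (colourI (row x) ∈ B₁ ∧ colourI (col y) ∉ B₁)
        then N x y else 0) =
      (Matrix.of fun x y => if (P (colourI (row x)) ∧ P (colourI (col y))) ∧ (colourI (row x) ∉ B ∧ colourI (col y) ∈ B)
        then N x y else 0) ∧
    (Matrix.of fun x y => if (P (colourI (row x)) ∧ P (colourI (col y))) ∧ (colourI (row x) ∉ B₁ ∧ colourI (col y) ∈ B₁)
        then N x y else 0) =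
      (Matrix.of fun x y => if (P (colourI (row x)) ∧ P (colourI (col y))) ∧ (colourI (row x) ∈ B ∧ colourI (col y) ∉ B)
        then N x y else 0) := by
  constructor
  · ext x y
    simp only [Matrix.of_apply]
    by_cases h1 : P (colourI (row x))
    · by_cases h2 : P (colourI (col y))
      · simp only [h _ h1, h _ h2, not_not]
      · simp [h2]
    · simp [h1]
  · ext x y
    simp only [Matrix.of_apply]
    by_cases h1 : P (colourI (row x))
    · by_cases h2 : P (colourI (col y))
      · simp only [h _ h1, h _ h2, not_not]
      · simp [h2]
    · simp [h1]

/-- **SYMMETRY of an exact first-family direct sum.**  If `M` has no visible data across `B₀`, its double cuts are invariant under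
complementing the first-family argument inside `B₀` and/or inside `B₀ᶜ`: `doubleCut B̃ B' M = doubleCut B B' M` whenever `B̃` and `B`
agree or are complementary on `B₀`, and agree or are complementary off `B₀`. -/
theorem doubleCut_eq_of_noCross (M : Matrix ι ι' K) (B₀ B B₁ : Finset (Fin n → Bool)) (B' : Finset (Fin n' → Bool))
    (hM : ∀ x y, (colourI (row x) ∈ B₀) ≠ (colourI (col y) ∈ B₀) → colourJ (row x) ≠ colourJ (col y) → M x y = 0)
    (h₀ : (∀ p, p ∈ B₀ → (p ∈ B₁ ↔ p ∈ B)) ∨ (∀ p, p ∈ B₀ → (p ∈ B₁ ↔ p ∉ B)))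
    (h₁ : (∀ p, p ∉ B₀ → (p ∈ B₁ ↔ p ∈ B)) ∨ (∀ p, p ∉ B₀ → (p ∈ B₁ ↔ p ∉ B))) :
    doubleCut row col B₁ B' M = doubleCut row col B B' M := by
  classical
  rw [doubleCut_split row col M B₀ B₁ B' hM, doubleCut_split row col M B₀ B B' hM]
  congr 1
  · rcases h₀ with h | h
    · obtain ⟨e1, e2⟩ := pieces_eq_of_agree row col (· ∈ B₀) (maskJ row col B' M) B B₁ h
      rw [e1, e2]
    · obtain ⟨e1, e2⟩ := pieces_eq_of_compl row col (· ∈ B₀) (maskJ row col B' M) B B₁ h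
      rw [e1, e2, Nat.add_comm]
  · rcases h₁ with h | h
    · obtain ⟨e1, e2⟩ := pieces_eq_of_agree row col (· ∉ B₀) (maskJ row col B' M) B B₁ h
      rw [e1, e2]
    · obtain ⟨e1, e2⟩ := pieces_eq_of_compl row col (· ∉ B₀) (maskJ row col B' M) B B₁ h
      rw [e1, e2, Nat.add_comm]

end General

/-! ## The MERGE setting: halves and their complementary profiles -/

section Merge

variable {n n' : ℕ} {ι ι' : Type} [Fintype ι] [Fintype ι'] [DecidableEq ι] [DecidableEq ι']
variable (row : ι → Fin n ⊕ Fin (n' + 1) → Bool) (col : ι' → Fin n ⊕ Fin (n' + 1) → Bool)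

omit [Fintype ι] [DecidableEq ι] [DecidableEq ι'] in
/-- The double cuts of the half `b` only see the second-family colours of `B'` whose last bit is `b`. -/
theorem doubleCut_half_eq_filter (D : Matrix ι ι' K) (b : Bool) (B : Finset (Fin n → Bool)) (B' : Finset (Fin (n' + 1) → Bool)) :
    doubleCut row col B B'
        (Matrix.of fun x y => if row x (Sum.inr (Fin.last n')) = b ∧ col y (Sum.inr (Fin.last n')) = b then D x y else 0) =
      doubleCut row col B (B'.filter fun σ => σ (Fin.last n') = b)
        (Matrix.of fun x y => if row x (Sum.inr (Fin.last n')) = b ∧ col y (Sum.inr (Fin.last n')) = b then D x y else 0) := by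
  have e : maskJ row col B'
        (Matrix.of fun x y => if row x (Sum.inr (Fin.last n')) = b ∧ col y (Sum.inr (Fin.last n')) = b then D x y else 0) =
      maskJ row col (B'.filter fun σ => σ (Fin.last n') = b)
        (Matrix.of fun x y => if row x (Sum.inr (Fin.last n')) = b ∧ col y (Sum.inr (Fin.last n')) = b then D x y else 0) := by
    ext x y
    simp only [maskJ, Matrix.of_apply, Finset.mem_filter, colourJ]
    by_cases hr : row x (Sum.inr (Fin.last n')) = b
    · by_cases hc : col y (Sum.inr (Fin.last n')) = b
      · simp [hr, hc]
      · simp [hc]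
    · simp [hr]
  unfold doubleCut
  rw [e]

/-- **COMPLEMENTARITY of the halves' profiles** (from `stub_halvesBudget`): with zero cross data at the last coordinate and all
double cuts of `D` at most `c`, for every first-family set `B` and ALL second-family sets `B'₀, B'₁`,
`doubleCut B B'₀ H₀ + doubleCut B B'₁ H₁ ≤ c`. -/
theorem halves_sum_le (D : Matrix ι ι' K) (c : ℕ) (hc : ∀ B B', doubleCut row col B B' D ≤ c)
    (hcross : ∀ x y, row x (Sum.inr (Fin.last n')) ≠ col y (Sum.inr (Fin.last n')) → D x y = 0)
    (B : Finset (Fin n → Bool)) (B'₀ B'₁ : Finset (Fin (n' + 1) → Bool)) :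
    doubleCut row col B B'₀
        (Matrix.of fun x y =>
          if row x (Sum.inr (Fin.last n')) = false ∧ col y (Sum.inr (Fin.last n')) = false then D x y else 0) +
      doubleCut row col B B'₁
        (Matrix.of fun x y =>
          if row x (Sum.inr (Fin.last n')) = true ∧ col y (Sum.inr (Fin.last n')) = true then D x y else 0) ≤ c := by
  classical
  have h := stub_halvesBudget K n n' ι ι' row col D hcross B
    (B'₀.filter (fun σ => σ (Fin.last n') = false) ∪ B'₁.filter (fun σ => σ (Fin.last n') = true))
  have e₀ : (B'₀.filter (fun σ => σ (Fin.last n') = false) ∪ B'₁.filter (fun σ => σ (Fin.last n') = true)).filter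
      (fun σ => σ (Fin.last n') = false) = B'₀.filter (fun σ => σ (Fin.last n') = false) := by
    ext σ
    simp only [Finset.mem_filter, Finset.mem_union]
    rcases Bool.eq_false_or_eq_true (σ (Fin.last n')) with hσ | hσ <;> simp [hσ]
  have e₁ : (B'₀.filter (fun σ => σ (Fin.last n') = false) ∪ B'₁.filter (fun σ => σ (Fin.last n') = true)).filter
      (fun σ => σ (Fin.last n') = true) = B'₁.filter (fun σ => σ (Fin.last n') = true) := by
    ext σ
    simp only [Finset.mem_filter, Finset.mem_union]
    rcases Bool.eq_false_or_eq_true (σ (Fin.last n')) with hσ | hσ <;> simp [hσ]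
  rw [e₀, e₁, ← doubleCut_half_eq_filter row col D false, ← doubleCut_half_eq_filter row col D true] at h
  rw [← h]
  exact hc B _

end Merge

/-! ## The registered stub -/

/-- **THE TWO-HALVES DISCOUNT** (registered tool stub W6 `stub_halvesDiscount` of the skeleton `Lines/rank_dehn_ladder.lean`, signature
verbatim).  In the MERGE setting (zero cross data at the last second-family coordinate, all double cuts `≤ c`), for every double cut `Φ₀` of
half `0` and every double cut `Φ₁` of half `1`: `65·(Φ₀ + Φ₁) ≤ 129·c` (the proof gives `33·(Φ₀ + Φ₁) ≤ 65·c`).  Memo g15 §7: surgery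
(Theorem 2 with the second-family colouring) makes half `1` an exact first-family direct sum across `B₀` at rank cost `4(c − Φ₀)` and half
`0` one across `B₁` at cost `4(c − Φ₁)`; at `B̃ := {p | p ∈ B₀ ↔ p ∈ B₁}` both modified halves show the given cuts (symmetry), and the
halves' profiles are complementary at `B̃`. -/
theorem stub_halvesDiscount :
    ∀ (K : Type) [Field K] (n n' : ℕ) (ι ι' : Type) [Fintype ι] [Fintype ι'] [DecidableEq ι] [DecidableEq ι']
      (row : ι → Fin n ⊕ Fin (n' + 1) → Bool) (col : ι' → Fin n ⊕ Fin (n' + 1) → Bool) (D : Matrix ι ι' K) (c : ℕ),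
      (∀ B B', Summit.PneNP.PneNP.Theorems.CnfIdealGenLengthRankDefectRepresentationsTwoFamilyCutDomination.doubleCut row col B B' D ≤ c) →
      (∀ x y, row x (Sum.inr (Fin.last n')) ≠ col y (Sum.inr (Fin.last n')) → D x y = 0) →
      ∀ (B₀ B₁ : Finset (Fin n → Bool)) (B'₀ B'₁ : Finset (Fin (n' + 1) → Bool)),
        65 * (Summit.PneNP.PneNP.Theorems.CnfIdealGenLengthRankDefectRepresentationsTwoFamilyCutDomination.doubleCut row col B₀ B'₀
              (Matrix.of fun x y =>
                if row x (Sum.inr (Fin.last n')) = false ∧ col y (Sum.inr (Fin.last n')) = false then D x y else 0) +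
            Summit.PneNP.PneNP.Theorems.CnfIdealGenLengthRankDefectRepresentationsTwoFamilyCutDomination.doubleCut row col B₁ B'₁
              (Matrix.of fun x y =>
                if row x (Sum.inr (Fin.last n')) = true ∧ col y (Sum.inr (Fin.last n')) = true then D x y else 0)) ≤ 129 * c := by
  intro K _ n n' ι ι' _ _ _ _ row col D c hc hcross B₀ B₁ B'₀ B'₁
  classical
  -- the two halves
  set H₀ : Matrix ι ι' K := Matrix.of fun x y =>
    if row x (Sum.inr (Fin.last n')) = false ∧ col y (Sum.inr (Fin.last n')) = false then D x y else 0 with hH₀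
  set H₁ : Matrix ι ι' K := Matrix.of fun x y =>
    if row x (Sum.inr (Fin.last n')) = true ∧ col y (Sum.inr (Fin.last n')) = true then D x y else 0 with hH₁
  -- (1) complementarity of the profiles, pointwise in the first-family argument
  have comp : ∀ (B : Finset (Fin n → Bool)) (Ba Bb : Finset (Fin (n' + 1) → Bool)),
      doubleCut row col B Ba H₀ + doubleCut row col B Bb H₁ ≤ c :=
    fun B Ba Bb => halves_sum_le row col D c hc hcross B Ba Bb
  have hΦ₀c : doubleCut row col B₀ B'₀ H₀ ≤ c := by have := comp B₀ B'₀ B'₁; omega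
  have hΦ₁c : doubleCut row col B₁ B'₁ H₁ ≤ c := by have := comp B₁ B'₀ B'₁; omega
  have hδ₀ : ∀ B', doubleCut row col B₀ B' H₁ ≤ c - doubleCut row col B₀ B'₀ H₀ := fun B' => by
    have := comp B₀ B'₀ B'; omega
  have hδ₁ : ∀ B', doubleCut row col B₁ B' H₀ ≤ c - doubleCut row col B₁ B'₁ H₁ := fun B' => by
    have := comp B₁ B' B'₁; omega
  -- (2) surgery: half 1 across `B₀`, half 0 across `B₁`
  obtain ⟨H₁', hr₁, hv₁⟩ := exists_noCross_of_cuts_le row col H₁ B₀ (c - doubleCut row col B₀ B'₀ H₀) hδ₀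
  obtain ⟨H₀', hr₀, hv₀⟩ := exists_noCross_of_cuts_le row col H₀ B₁ (c - doubleCut row col B₁ B'₁ H₁) hδ₁
  -- (3) symmetry at `B̃ := {p | p ∈ B₀ ↔ p ∈ B₁}`
  set Bt : Finset (Fin n → Bool) := Finset.univ.filter fun p => (p ∈ B₀ ↔ p ∈ B₁) with hBt
  have s₁ : doubleCut row col Bt B'₁ H₁' = doubleCut row col B₁ B'₁ H₁' := by
    refine doubleCut_eq_of_noCross row col H₁' B₀ B₁ Bt B'₁ hv₁ (Or.inl ?_) (Or.inr ?_)
    · intro p hp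
      simp [hBt, hp]
    · intro p hp
      simp [hBt, hp]
  have s₀ : doubleCut row col Bt B'₀ H₀' = doubleCut row col B₀ B'₀ H₀' := by
    refine doubleCut_eq_of_noCross row col H₀' B₁ B₀ Bt B'₀ hv₀ (Or.inl ?_) (Or.inr ?_)
    · intro p hp
      simp [hBt, hp]
    · intro p hp
      simp [hBt, hp]
  -- (4) perturbation bounds and assembly
  have p₁ := doubleCut_le_add_rank_sub row col B₁ B'₁ H₁ H₁'
  have q₁ := doubleCut_le_add_rank_sub row col Bt B'₁ H₁' H₁
  have p₀ := doubleCut_le_add_rank_sub row col B₀ B'₀ H₀ H₀'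
  have q₀ := doubleCut_le_add_rank_sub row col Bt B'₀ H₀' H₀
  have n₁ : (H₁' - H₁).rank = (H₁ - H₁').rank := by rw [← neg_sub, rank_neg']
  have n₀ : (H₀' - H₀).rank = (H₀ - H₀').rank := by rw [← neg_sub, rank_neg']
  have key := comp Bt B'₀ B'₁
  rw [n₁, s₁] at q₁
  rw [n₀, s₀] at q₀
  omega

end Summit.PneNP.PneNP.Theorems.CnfIdealGenLengthRankDefectRepresentationsHalvesDiscount
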